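import Summits.Schanuel.Schanuel.Theorems.RootDecomp1BTwoStorey02

/-!
# RootDecomp1BTwoStorey — lens 4, generation 43 «TWO-PARAMETER RADICAL DESCENT: STOREY THREE AT (1, ρ, σ)» (lane B-R26 (e); CLAIM L2197, ACK/CHECKLIST B-g43 L2199, NODE L2206 / REQUEST L2207, writer re-check L2211, critic VERDICT L2210: CLEARED — ONE CELL (lane (e) «m = 3 storeys»; engine VARIANT-REACH+ of g30, class NEW-LOCAL, territory NEW); RULE B-R29; lens-4 tally THEOREM ×7 + CELL ×4) — continuation (RootDecomp1BTwoStorey03): §C part 2 (Kronecker collision, two-dimensional non-vanishing, typed obstruction)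

(lens-4 g43 HOME kernel K = HOME/decomp-schanuel-lens-4/g43/TwoStorey.lean 24f29895…, 1683 l; VERDICT L2210 PORT GO; port by census-1 gen 19 as `RootDecomp1BTwoStorey01`–`06`: 01 = §A formal algebra + §B sizes; 02 = §D-data + §C part 1 (classes `UltraLiouville₂` / `JU`); 03 = §C part 2 (collision, two-dimensional non-vanishing, typed obstruction); 04 = §C part 3 (Baire density, controls); 05 = §D kernel `algebraicIndependent_radical₂` (pending cap edition); 06 = §E storey-three cells.
PORT EDITS: class defs' docstrings tagged «[class] definition …»; private port copies of length lemmas kept private (per-part private copies where a later part uses them); statements and proofs verbatim. `--supports stmt-Schanuel-24622`; no census credit carried; rung 0 — nothing here proves Schanuel.)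
-/

noncomputable section

open Complex

namespace Summit.Schanuel.Schanuel.Theorems.RootDecomp1BTwoStorey

open Summit.Schanuel.Schanuel.Theorems.RootDecomp1BRadicalDescent (resFin resFin_val powSubst powSubst_X_self
  powSubst_eq_zero_iff QDiv qdiv_powSubst residue_lemma)

section PortCopies2
open MvPolynomial
open Summit.Schanuel.Schanuel.Theorems.RootDecomp1KHyper (mvlen mvlen_nonneg mvlen_eq_sum_of_support_subset)
variable {n : ℕ}

/-- The length of a monomial `c · x^m` is at most `|c|`. -/
private theorem mvlen_monomial_le (m : Fin n →₀ ℕ) (c : ℤ) : mvlen (monomial m c) ≤ |c| := by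
  classical
  rw [mvlen_eq_sum_of_support_subset _ support_monomial_subset, Finset.sum_singleton, coeff_monomial,
    if_pos rfl]

/-- Subadditivity of the length. -/
private theorem mvlen_add_le (P Q : MvPolynomial (Fin n) ℤ) : mvlen (P + Q) ≤ mvlen P + mvlen Q := by
  classical
  rw [mvlen_eq_sum_of_support_subset _ support_add,
    mvlen_eq_sum_of_support_subset P (Finset.subset_union_left (s₂ := Q.support)),
    mvlen_eq_sum_of_support_subset Q (Finset.subset_union_right (s₁ := P.support)),
    ← Finset.sum_add_distrib]
  exact Finset.sum_le_sum fun m _ => by rw [coeff_add]; exact abs_add_le _ _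

end PortCopies2

section ClassJU
open MvPolynomial
open Summit.Schanuel.Schanuel.Theorems.RootDecomp1BRadicalDescent (UltraLiouville DExpMeasure)
open Summit.Schanuel.Schanuel.Theorems.RootDecomp1KHyper (mvlen mvlen_nonneg one_le_mvlen mvaeval_int_map)

variable {ρ σ : ℝ}

/-- `(1, ρ, σ)` is `ℚ`-free when `(ρ, σ)` is algebraically independent (the `ℚ`-freeness hypothesis of the crux
`KleinPolarSchanuel` at `r = (1, ρ, σ)`, and the input of the Kronecker collision lemma). -/
theorem linearIndependent_one_of_algebraicIndependent (hai : AlgebraicIndependent ℚ ![(ρ : ℂ), (σ : ℂ)]) :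
    LinearIndependent ℚ ![(1 : ℝ), ρ, σ] := by
  rw [Fintype.linearIndependent_iff]
  intro g hg
  have hsum : ((g 0 : ℚ) : ℝ) + (g 1 : ℚ) * ρ + (g 2 : ℚ) * σ = 0 := by
    simpa [Fin.sum_univ_three, Rat.smul_def] using hg
  have hμ : (C (g 0) + C (g 1) * X 0 + C (g 2) * X 1 : MvPolynomial (Fin 2) ℚ) = 0 := by
    refine algebraicIndependent_iff.1 hai _ ?_
    have h := congrArg (fun x : ℝ => (x : ℂ)) hsum
    simp only [Complex.ofReal_add, Complex.ofReal_mul, Complex.ofReal_ratCast, Complex.ofReal_zero] at h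
    simp only [map_add, map_mul, aeval_C, aeval_X, Matrix.cons_val_zero, Matrix.cons_val_one,
      eq_ratCast]
    exact h
  have e00 := congrArg (MvPolynomial.eval ![(0 : ℚ), 0]) hμ
  have e10 := congrArg (MvPolynomial.eval ![(1 : ℚ), 0]) hμ
  have e01 := congrArg (MvPolynomial.eval ![(0 : ℚ), 1]) hμ
  simp only [map_add, map_mul, eval_C, eval_X, Matrix.cons_val_zero, Matrix.cons_val_one,
    map_zero, mul_zero, mul_one, add_zero] at e00 e10 e01
  intro i
  fin_cases i
  · exact e00
  · simpa [e00] using e10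
  · simpa [e00] using e01

/-- Integer relations `x ρ + y σ + z = 0` force `x = y = 0` when `(1, ρ, σ)` is `ℚ`-free. -/
theorem int_rel_eq_zero (hli : LinearIndependent ℚ ![(1 : ℝ), ρ, σ]) {x y z : ℤ}
    (h : (x : ℝ) * ρ + y * σ + z = 0) : x = 0 ∧ y = 0 := by
  have h1 := Fintype.linearIndependent_iff.1 hli ![(z : ℚ), x, y] (by
    simp only [Fin.sum_univ_three, Matrix.cons_val_zero, Matrix.cons_val_one, Matrix.cons_val_two,
      Matrix.tail_cons, Matrix.head_cons, Rat.smul_def, Rat.cast_intCast, mul_one]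
    linarith [h])
  have hx : (x : ℚ) = 0 := by simpa using h1 1
  have hy : (y : ℚ) = 0 := by simpa using h1 2
  exact ⟨by exact_mod_cast hx, by exact_mod_cast hy⟩

/-- A finite family of positive reals has a positive lower bound (`1` if the family is empty). -/
private theorem exists_pos_le_of_finset {ι : Type*} (B : Finset ι) (f : ι → ℝ) (hf : ∀ v ∈ B, 0 < f v) :
    ∃ c : ℝ, 0 < c ∧ ∀ v ∈ B, c ≤ f v := by
  classical
  rcases B.eq_empty_or_nonempty with he | hne
  · exact ⟨1, one_pos, fun v hv => by rw [he] at hv; simp at hv⟩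
  · obtain ⟨v₀, hv₀, hmin⟩ := B.exists_min_image f hne
    exact ⟨f v₀, hf v₀ hv₀, hmin⟩

/-- **KRONECKER COLLISION LEMMA.** If `(1, ρ, σ)` is `ℚ`-free then for every box size `K` there is `ε > 0` such
that for every simultaneous approximation `(a/q, b/q)` of `(ρ, σ)` within `ε` the exponents `a k₁ + b k₂`
(`k₁, k₂ ≤ K`) are PAIRWISE DISTINCT MODULO `q`: a collision `a x + b y = z q` with `(x, y) ≠ 0` in the box would
be a short integer relation `|x ρ + y σ − z·(…)| ≪ ε`, excluded by Kronecker (the finitely many box relations are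
bounded away from zero). -/
theorem collision_free (hli : LinearIndependent ℚ ![(1 : ℝ), ρ, σ]) (K : ℕ) :
    ∃ ε : ℝ, 0 < ε ∧ ∀ (q a b : ℕ), 0 < q → |ρ - (a : ℝ) / q| < ε → |σ - (b : ℝ) / q| < ε →
      ∀ k₁ k₂ k₁' k₂' : ℕ, k₁ ≤ K → k₂ ≤ K → k₁' ≤ K → k₂' ≤ K →
        (a * k₁ + b * k₂) % q = (a * k₁' + b * k₂') % q → k₁ = k₁' ∧ k₂ = k₂' := by
  classical
  -- the finite box of candidate relations and its positive minimum
  set Z : ℕ := K * (⌈|ρ|⌉₊ + ⌈|σ|⌉₊ + 2) with hZ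
  set B : Finset (ℤ × ℤ × ℤ) :=
    ((Finset.Icc (-(K : ℤ)) K) ×ˢ ((Finset.Icc (-(K : ℤ)) K) ×ˢ (Finset.Icc (-(Z : ℤ)) Z))).filter
      (fun v => v.1 ≠ 0 ∨ v.2.1 ≠ 0) with hB
  obtain ⟨c, hc, hcle⟩ := exists_pos_le_of_finset B (fun v => |(v.1 : ℝ) * ρ + v.2.1 * σ + v.2.2|) (by
    intro v hv
    have hv' := (Finset.mem_filter.1 hv).2
    refine abs_pos.2 fun h0 => ?_
    obtain ⟨hx, hy⟩ := int_rel_eq_zero hli h0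
    rcases hv' with h | h
    · exact h hx
    · exact h hy)
  refine ⟨min 1 (c / (2 * K + 1)), lt_min one_pos (by positivity), ?_⟩
  intro q a b hq hρa hσb k₁ k₂ k₁' k₂' hk₁ hk₂ hk₁' hk₂' hmod
  have hq0r : (0 : ℝ) < q := by exact_mod_cast hq
  have hε1 : min (1 : ℝ) (c / (2 * K + 1)) ≤ 1 := min_le_left _ _
  have hεc : min (1 : ℝ) (c / (2 * K + 1)) ≤ c / (2 * K + 1) := min_le_right _ _
  -- the collision as an integer relation  a x + b y = q z
  set x : ℤ := (k₁ : ℤ) - k₁' with hx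
  set y : ℤ := (k₂ : ℤ) - k₂' with hy
  obtain ⟨z, hz⟩ : ∃ z : ℤ, (a : ℤ) * x + b * y = q * z := by
    have hdvd := (Nat.modEq_iff_dvd.1 hmod.symm)
    obtain ⟨z, hz⟩ := hdvd
    refine ⟨z, ?_⟩
    rw [hx, hy]
    push_cast at hz ⊢
    linarith
  by_cases hxy : x = 0 ∧ y = 0
  · constructor <;> omega
  exfalso
  -- sizes: |x|, |y| ≤ K, |z| ≤ Z
  have hxK : |x| ≤ K := by rw [hx, abs_le]; constructor <;> omega
  have hyK : |y| ≤ K := by rw [hy, abs_le]; constructor <;> omega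
  have haq : (a : ℝ) / q < |ρ| + 1 := by
    have h1 : |(a : ℝ) / q| ≤ |ρ - (a : ℝ) / q| + |ρ| := by
      have := abs_sub_abs_le_abs_sub ((a : ℝ) / q) ρ
      rw [abs_sub_comm] at this; linarith
    have h2 : (a : ℝ) / q ≤ |(a : ℝ) / q| := le_abs_self _
    linarith [hρa.trans_le hε1]
  have hbq : (b : ℝ) / q < |σ| + 1 := by
    have h1 : |(b : ℝ) / q| ≤ |σ - (b : ℝ) / q| + |σ| := by
      have := abs_sub_abs_le_abs_sub ((b : ℝ) / q) σ
      rw [abs_sub_comm] at this; linarith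
    have h2 : (b : ℝ) / q ≤ |(b : ℝ) / q| := le_abs_self _
    linarith [hσb.trans_le hε1]
  have hzZ : |z| ≤ Z := by
    have hxR : |(x : ℝ)| ≤ K := by exact_mod_cast hxK
    have hyR : |(y : ℝ)| ≤ K := by exact_mod_cast hyK
    have hzR : (q : ℝ) * |(z : ℝ)| ≤ (a : ℝ) * K + b * K := by
      have h1 : ((q : ℝ)) * z = a * x + b * y := by exact_mod_cast hz.symm
      calc (q : ℝ) * |(z : ℝ)| = |(a : ℝ) * x + b * y| := by
            rw [← abs_of_pos hq0r, ← abs_mul, h1]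
        _ ≤ |(a : ℝ) * x| + |(b : ℝ) * y| := abs_add_le _ _
        _ = a * |(x : ℝ)| + b * |(y : ℝ)| := by
            rw [abs_mul, abs_mul, Nat.abs_cast, Nat.abs_cast]
        _ ≤ a * K + b * K := add_le_add (mul_le_mul_of_nonneg_left hxR (Nat.cast_nonneg a))
            (mul_le_mul_of_nonneg_left hyR (Nat.cast_nonneg b))
    have hρc : |ρ| ≤ ⌈|ρ|⌉₊ := Nat.le_ceil _
    have hσc : |σ| ≤ ⌈|σ|⌉₊ := Nat.le_ceil _
    have h3 : |(z : ℝ)| ≤ Z := by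
      rw [hZ]; push_cast
      have ha' : (a : ℝ) < (|ρ| + 1) * q := by rwa [div_lt_iff₀ hq0r] at haq
      have hb' : (b : ℝ) < (|σ| + 1) * q := by rwa [div_lt_iff₀ hq0r] at hbq
      have hK0 : (0 : ℝ) ≤ K := Nat.cast_nonneg K
      have t1 : (a : ℝ) * K ≤ (|ρ| + 1) * q * K := mul_le_mul_of_nonneg_right ha'.le hK0
      have t2 : (b : ℝ) * K ≤ (|σ| + 1) * q * K := mul_le_mul_of_nonneg_right hb'.le hK0
      have t3 : (|ρ| + |σ| + 2) * ((q : ℝ) * K) ≤ ((⌈|ρ|⌉₊ : ℝ) + ⌈|σ|⌉₊ + 2) * ((q : ℝ) * K) :=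
        mul_le_mul_of_nonneg_right (by linarith) (by positivity)
      have h4 : (q : ℝ) * |(z : ℝ)| ≤ (q : ℝ) * (K * (⌈|ρ|⌉₊ + ⌈|σ|⌉₊ + 2)) := by
        have e1 : (|ρ| + 1) * q * K + (|σ| + 1) * q * K = (|ρ| + |σ| + 2) * ((q : ℝ) * K) := by ring
        have e2 : ((⌈|ρ|⌉₊ : ℝ) + ⌈|σ|⌉₊ + 2) * ((q : ℝ) * K) = (q : ℝ) * (K * (⌈|ρ|⌉₊ + ⌈|σ|⌉₊ + 2)) := by
          ring
        linarith [hzR, t1, t2, t3, e1, e2]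
      exact le_of_mul_le_mul_left h4 hq0r
    have : ((|z| : ℤ) : ℝ) ≤ (Z : ℝ) := by push_cast; exact h3
    exact_mod_cast this
  -- (x, y, z') is a box relation, so it is ≥ c; but it is < 2Kε ≤ c
  have hmem : (x, y, -z) ∈ B := by
    rw [hB, Finset.mem_filter]
    refine ⟨?_, not_and_or.1 hxy⟩
    simp only [Finset.mem_product, Finset.mem_Icc]
    exact ⟨abs_le.1 hxK, abs_le.1 hyK, abs_le.1 (by rw [abs_neg]; exact hzZ)⟩
  have hrel : (x : ℝ) * ρ + y * σ + ((-z : ℤ) : ℝ) = x * (ρ - a / q) + y * (σ - b / q) := by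
    have h1 : ((q : ℝ)) * z = a * x + b * y := by exact_mod_cast hz.symm
    push_cast
    field_simp
    linarith [h1]
  have hlow := hcle _ hmem
  simp only at hlow
  rw [hrel] at hlow
  have hup : |(x : ℝ) * (ρ - a / q) + y * (σ - b / q)| < c := by
    have hxR : |(x : ℝ)| ≤ K := by exact_mod_cast hxK
    have hyR : |(y : ℝ)| ≤ K := by exact_mod_cast hyK
    have hK0 : (0 : ℝ) ≤ K := Nat.cast_nonneg K
    have hεK : (K : ℝ) * (c / (2 * K + 1)) + K * (c / (2 * K + 1)) < c := by
      have e1 : (K : ℝ) * (c / (2 * K + 1)) + K * (c / (2 * K + 1)) = c * (2 * K) / (2 * K + 1) := by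
        ring
      rw [e1, div_lt_iff₀ (by positivity)]
      nlinarith [hc]
    calc |(x : ℝ) * (ρ - a / q) + y * (σ - b / q)|
        ≤ |(x : ℝ) * (ρ - a / q)| + |(y : ℝ) * (σ - b / q)| := abs_add_le _ _
      _ = |(x : ℝ)| * |ρ - a / q| + |(y : ℝ)| * |σ - b / q| := by rw [abs_mul, abs_mul]
      _ ≤ K * (c / (2 * K + 1)) + K * (c / (2 * K + 1)) :=
          add_le_add (mul_le_mul hxR (hρa.le.trans hεc) (abs_nonneg _) hK0)
            (mul_le_mul hyR (hσb.le.trans hεc) (abs_nonneg _) hK0)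
      _ < c := hεK
  linarith

/-- **TWO-DIMENSIONAL NON-VANISHING.** A nonzero integer polynomial `μ(Y₁, Y₂)` does not vanish at the
algebraically independent point `(ρ, σ)`, hence (continuity) at no point of a small ball around it — in
particular at the approximants `(a/q, b/q)` eventually. (Replaces g30's one-variable `exists_ball_eval_ne_zero`
+ `r ≠ ρ`: in two variables the zero set is a curve, and `(a/q, b/q)` must avoid it.) -/
theorem exists_ball_aeval_ne_zero₂ (hai : AlgebraicIndependent ℚ ![(ρ : ℂ), (σ : ℂ)])
    (μ : MvPolynomial (Fin 2) ℤ) (hμ : μ ≠ 0) :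
    ∃ δ₀ : ℝ, 0 < δ₀ ∧ ∀ x : ℝ × ℝ, dist x (ρ, σ) < δ₀ → aeval ![(x.1 : ℂ), (x.2 : ℂ)] μ ≠ 0 := by
  have hne : aeval ![(ρ : ℂ), (σ : ℂ)] μ ≠ 0 := aeval_ne_zero_of_algebraicIndependent hai μ hμ
  have hev : ∀ x : ℝ × ℝ, aeval ![(x.1 : ℂ), (x.2 : ℂ)] μ =
      ∑ m ∈ μ.support, ((μ.coeff m : ℤ) : ℂ) * ((x.1 : ℂ) ^ (m 0) * (x.2 : ℂ) ^ (m 1)) := by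
    intro x
    rw [MvPolynomial.aeval_def, MvPolynomial.eval₂_eq']
    refine Finset.sum_congr rfl fun m _ => ?_
    rw [Fin.prod_univ_two]
    simp
  have hcont : Continuous fun x : ℝ × ℝ => aeval ![(x.1 : ℂ), (x.2 : ℂ)] μ := by
    simp_rw [hev]
    exact continuous_finsetSum _ fun m _ => continuous_const.mul
      (((Complex.continuous_ofReal.comp continuous_fst).pow _).mul
        ((Complex.continuous_ofReal.comp continuous_snd).pow _))
  have hρσ : (fun x : ℝ × ℝ => aeval ![(x.1 : ℂ), (x.2 : ℂ)] μ) (ρ, σ) ≠ 0 := hne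
  have hevn := (hcont.continuousAt (x := (ρ, σ))).eventually_ne hρσ
  obtain ⟨δ₀, hδ₀, h⟩ := Metric.eventually_nhds_iff.1 hevn
  exact ⟨δ₀, hδ₀, fun x hx => h hx⟩

/-- **TYPED OBSTRUCTION (why the one-parameter kernel `algebraicIndependent_radical` cannot be iterated to a
second storey).** A tuple with a LIOUVILLE coordinate has NO `DExpMeasure`: at fixed degree the measure is
polynomial in the height (`‖P(θ)‖ ≥ e^{−c}·len(P)^{−c}`), and `P = q X₀ − p` at the Liouville approximants beats
every such bound.  Iterating g30's kernel would need `DExpMeasure (ρ, θ)` (or of a tuple containing `ρ`) —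
false for every (ultra-)Liouville `ρ`. -/
theorem not_dExpMeasure_cons_of_liouville {n : ℕ} {x : ℝ} (hx : Liouville x) (θ : Fin n → ℂ) :
    ¬ DExpMeasure (Fin.cons (x : ℂ) θ : Fin (n + 1) → ℂ) := by
  classical
  rintro ⟨A, hA⟩
  -- constants: c = the degree factor at degree ≤ 1; C₁ log b ≥ log len + 1 for b ≥ 2
  set c : ℝ := Real.exp ((A : ℝ) * ((1 : ℝ) + 1) ^ A) with hc
  have hc0 : 0 < c := Real.exp_pos _
  set C₁ : ℝ := (Real.log (|x| + 2) + 1) / Real.log 2 + 1 with hC₁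
  have hlog2 : 0 < Real.log 2 := Real.log_pos (by norm_num)
  have hLx : 0 < Real.log (|x| + 2) + 1 := by
    have := Real.log_nonneg (show (1 : ℝ) ≤ |x| + 2 by linarith [abs_nonneg x]); linarith
  have hC₁0 : 0 < C₁ := by rw [hC₁]; positivity
  obtain ⟨m, hm⟩ := exists_nat_gt (C₁ * c)
  obtain ⟨a, b, hb1, -, hlt⟩ := hx (m + 1)
  have hb0 : (0 : ℝ) < b := by exact_mod_cast (zero_lt_one.trans hb1)
  have hb2 : (2 : ℝ) ≤ b := by exact_mod_cast hb1
  -- the polynomial  P = b X₀ − a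
  set P : MvPolynomial (Fin (n + 1)) ℤ := monomial (Finsupp.single 0 1) b + monomial 0 (-a) with hP
  have hPcoeff : P.coeff (Finsupp.single 0 1) = b := by
    rw [hP, coeff_add, coeff_monomial, coeff_monomial, if_pos rfl, if_neg, add_zero]
    intro h
    have := congrArg (fun f : Fin (n + 1) →₀ ℕ => f 0) h
    simp at this
  have hP0 : P ≠ 0 := by
    intro h; rw [h, coeff_zero] at hPcoeff
    exact (zero_lt_one.trans hb1).ne' (by exact_mod_cast hPcoeff.symm)
  have hPdeg : P.totalDegree ≤ 1 := by
    rw [hP]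
    refine (totalDegree_add _ _).trans (max_le ((totalDegree_monomial_le _ _).trans ?_)
      ((totalDegree_monomial_le _ _).trans ?_))
    · simp
    · simp
  have hPlen : (mvlen P : ℝ) ≤ (b : ℝ) + |(a : ℝ)| := by
    have h1 : mvlen P ≤ |(b : ℤ)| + |(-a : ℤ)| :=
      (mvlen_add_le _ _).trans (add_le_add (mvlen_monomial_le _ _) (mvlen_monomial_le _ _))
    rw [abs_neg, abs_of_pos (zero_lt_one.trans hb1)] at h1
    exact_mod_cast h1
  have hPval : ‖aeval (Fin.cons (x : ℂ) θ : Fin (n + 1) → ℂ) P‖ = |(b : ℝ) * x - a| := by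
    rw [hP, map_add, aeval_monomial, aeval_monomial, Finsupp.prod_single_index (by simp),
      Finsupp.prod_zero_index]
    simp only [Fin.cons_zero, pow_one, mul_one, algebraMap_int_eq, eq_intCast, Int.cast_neg]
    rw [show ((b : ℂ)) * (x : ℂ) + -(a : ℂ) = (((b : ℝ) * x - a : ℝ) : ℂ) by push_cast; ring,
      Complex.norm_real, Real.norm_eq_abs]
  -- upper bound  |b x − a| < 1 / b^m
  have hup : |(b : ℝ) * x - a| < 1 / (b : ℝ) ^ m := by
    have h1 : |(b : ℝ) * x - a| = (b : ℝ) * |x - a / b| := by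
      rw [← abs_of_pos hb0, ← abs_mul, abs_of_pos hb0, mul_sub, mul_div_cancel₀ _ hb0.ne']
    rw [h1]
    calc (b : ℝ) * |x - a / b| < b * (1 / (b : ℝ) ^ (m + 1)) := mul_lt_mul_of_pos_left hlt hb0
      _ = 1 / (b : ℝ) ^ m := by rw [pow_succ]; field_simp
  -- lower bound from the measure  ≥ exp(−(log len + 1) c) ≥ exp(−m log b) = 1/b^m
  have hlow := hA P hP0
  rw [hPval] at hlow
  have hlenpos : (0 : ℝ) < mvlen P := by
    have := one_le_mvlen hP0; exact_mod_cast (show (0 : ℤ) < mvlen P by omega)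
  have hlen1 : 0 ≤ Real.log (mvlen P : ℝ) := Real.log_nonneg (by exact_mod_cast one_le_mvlen hP0)
  have hdegc : Real.exp ((A : ℝ) * ((P.totalDegree : ℝ) + 1) ^ A) ≤ c := by
    rw [hc, Real.exp_le_exp]
    refine mul_le_mul_of_nonneg_left (pow_le_pow_left₀ (by positivity) ?_ A) (Nat.cast_nonneg A)
    have : (P.totalDegree : ℝ) ≤ 1 := by exact_mod_cast hPdeg
    linarith
  have hlenb : Real.log (mvlen P : ℝ) + 1 ≤ C₁ * Real.log b := by
    have ha' : |(a : ℝ)| < (|x| + 1) * b := by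
      have h1 : |x - a / b| < 1 := by
        refine hlt.trans_le ?_
        rw [div_le_one (pow_pos hb0 _)]
        exact one_le_pow₀ (by linarith)
      have h2 : |(a : ℝ) / b| < |x| + 1 := by
        have := abs_sub_abs_le_abs_sub ((a : ℝ) / b) x
        rw [abs_sub_comm] at this; linarith
      rw [abs_div, abs_of_pos hb0, div_lt_iff₀ hb0] at h2
      exact h2
    have h3 : (mvlen P : ℝ) ≤ (|x| + 2) * b := by nlinarith [hPlen, ha', hb0]
    have h4 : Real.log (mvlen P : ℝ) ≤ Real.log (|x| + 2) + Real.log b := by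
      rw [← Real.log_mul (by positivity) hb0.ne']
      exact Real.log_le_log hlenpos h3
    have hlogb : Real.log 2 ≤ Real.log b := Real.log_le_log (by norm_num) hb2
    have h5 : Real.log (|x| + 2) + 1 ≤ (Real.log (|x| + 2) + 1) / Real.log 2 * Real.log b := by
      rw [div_mul_eq_mul_div, le_div_iff₀ hlog2]
      exact mul_le_mul_of_nonneg_left hlogb hLx.le
    rw [hC₁, add_mul, one_mul]
    linarith
  have hexp : Real.exp (-((m : ℝ) * Real.log b)) ≤
      Real.exp (-((Real.log (mvlen P : ℝ) + 1) * Real.exp ((A : ℝ) * ((P.totalDegree : ℝ) + 1) ^ A))) := by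
    rw [Real.exp_le_exp, neg_le_neg_iff]
    have hlogb0 : 0 ≤ Real.log b := Real.log_nonneg (by linarith)
    calc (Real.log (mvlen P : ℝ) + 1) * Real.exp ((A : ℝ) * ((P.totalDegree : ℝ) + 1) ^ A)
        ≤ (C₁ * Real.log b) * c := mul_le_mul hlenb hdegc (Real.exp_pos _).le (by positivity)
      _ = (C₁ * c) * Real.log b := by ring
      _ ≤ m * Real.log b := mul_le_mul_of_nonneg_right hm.le hlogb0
  have hbm : Real.exp (-((m : ℝ) * Real.log b)) = 1 / (b : ℝ) ^ m := by
    rw [Real.exp_neg, ← Real.log_pow, Real.exp_log (pow_pos hb0 _), one_div]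
  linarith [hexp.trans hlow, hup, hbm.symm.le, hbm.le]

end ClassJU

end Summit.Schanuel.Schanuel.Theorems.RootDecomp1BTwoStorey

end
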